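import Literature.Analysis.FluidPDE.ElgindiPsiStar
import Literature.Analysis.FluidPDE.ElgindiPolarIBP
import Mathlib.MeasureTheory.Integral.Prod
import HarnessLib

/-!
# The energy identity of the polar model operator ([Elgindi2021] §7.1, Proposition 7.1 Step 2)

Topic `Literature/Analysis/FluidPDE`. Proof file (everything proved, no definitions, no named
facts) on the proof path of the named fact
`Literature.Analysis.FluidPDE.Elgindi.ElgindiGhoulMasmoudi2021_stabilityCore`
(`ElgindiStabilityDecomposition.lean`). T. M. Elgindi, Ann. of Math. 194 (2021) =
arXiv:1904.04795, §7.1 proof of Proposition 7.1, Step 2 (p. 19):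

> "Multiplying (PolarBSL) by `Ψ` and integrating we get
> `α²|R∂_RΨ|² − α²|Ψ|² + (α(5+α)/2)|Ψ|² + |∂_θΨ|² − 6|Ψ|² + ½|sec(θ)Ψ|² = (F,Ψ)`."

Exactly this, in `L²(dR dθ)` of the open strip `R > 0`, `0 < θ < π/2`, for the a-priori class of
profiles `Ψ = cosθ·χ` with `χ ∈ C²(ℝ²)` compactly supported and `χ(R,0) = 0` (so that
`Ψ(R,0) = Ψ(R,π/2) = 0`, `sec(θ)Ψ = χ` and `∂_θ(tanθΨ) = ∂_θ(sinθχ)`): Fubini over the strip and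
the four one-dimensional integrations by parts of `ElgindiPolarIBP.lean`
(`integral_strip_ellipticOp_mul_self`).
-/

noncomputable section

open MeasureTheory Set Real Filter Function intervalIntegral
open _root_.Topology

namespace Literature.Analysis.FluidPDE

namespace Elgindi

/-! ### Fubini over the strip -/

/-- `∫∫_strip G = ∫_{R>0}∫_{0<θ<π/2} G`. [folklore] -/
theorem integral_strip_eq_integral_Ioi_integral_Ioo {G : ℝ × ℝ → ℝ} (hG : Integrable G) :
    ∫ p in strip, G p = ∫ R in Ioi (0 : ℝ), ∫ θ in Ioo 0 (π / 2), G (R, θ) := by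
  have h : IntegrableOn G (Ioi (0 : ℝ) ×ˢ Ioo 0 (π / 2)) ((volume : Measure ℝ).prod volume) := by
    rw [← Measure.volume_eq_prod]; exact hG.integrableOn
  have := setIntegral_prod G h
  rw [← Measure.volume_eq_prod] at this
  exact this

/-- `∫∫_strip G = ∫_{0<θ<π/2}∫_{R>0} G`. [folklore] -/
theorem integral_strip_eq_integral_Ioo_integral_Ioi {G : ℝ × ℝ → ℝ} (hG : Integrable G) :
    ∫ p in strip, G p = ∫ θ in Ioo 0 (π / 2), ∫ R in Ioi (0 : ℝ), G (R, θ) := by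
  rw [integral_strip_eq_integral_Ioi_integral_Ioo hG]
  have h : Integrable (uncurry fun R θ => G (R, θ)) ((volume.restrict (Ioi (0 : ℝ))).prod (volume.restrict (Ioo 0 (π / 2)))) := by
    rw [Measure.prod_restrict, ← Measure.volume_eq_prod]
    exact hG.integrableOn.integrable
  exact integral_integral_swap h

/-! ### The profile class `Ψ = cosθ·χ` -/

section profile

variable {χ : ℝ → ℝ → ℝ}

/-- `uncurry (cos·χ)` is `Cⁿ` when `χ` is. [folklore] -/
theorem contDiff_cosProfile {n : WithTop ℕ∞} (hχ : ContDiff ℝ n (uncurry χ)) :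
    ContDiff ℝ n (uncurry fun R θ => Real.cos θ * χ R θ) := by
  have e : uncurry (fun R θ => Real.cos θ * χ R θ) = fun p : ℝ × ℝ => Real.cos p.2 * uncurry χ p := by
    funext p; rfl
  rw [e]
  exact (Real.contDiff_cos.comp contDiff_snd).mul hχ

/-- `uncurry (cos·χ)` is compactly supported when `χ` is. [folklore] -/
theorem hasCompactSupport_cosProfile (hs : HasCompactSupport (uncurry χ)) :
    HasCompactSupport (uncurry fun R θ => Real.cos θ * χ R θ) := by
  have e : uncurry (fun R θ => Real.cos θ * χ R θ) = fun p : ℝ × ℝ => Real.cos p.2 * uncurry χ p := by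
    funext p; rfl
  rw [e]
  exact hs.mul_left

/-- The radial slice derivative of the profile. [folklore] -/
theorem dz_cosProfile (hχ : ContDiff ℝ 1 (uncurry χ)) (R θ : ℝ) :
    dz (fun R θ => Real.cos θ * χ R θ) R θ = Real.cos θ * dz χ R θ := by
  have e : (fun R' => χ R' θ) = uncurry χ ∘ fun R' => (R', θ) := rfl
  have hd : DifferentiableAt ℝ (fun R' => χ R' θ) R := by
    rw [e]; exact ((hχ.differentiable (by simp)) (R, θ)).comp R (differentiableAt_id.prodMk (differentiableAt_const _))
  show deriv (fun R' => Real.cos θ * χ R' θ) R = Real.cos θ * deriv (fun R' => χ R' θ) R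
  exact deriv_const_mul _ hd

/-- The angular slice derivative of the profile. [folklore] -/
theorem dθ_cosProfile (hχ : ContDiff ℝ 1 (uncurry χ)) (R θ : ℝ) :
    dθ (fun R θ => Real.cos θ * χ R θ) R θ = -Real.sin θ * χ R θ + Real.cos θ * dθ χ R θ := by
  have e : (fun θ' => χ R θ') = uncurry χ ∘ fun θ' => (R, θ') := rfl
  have hd : DifferentiableAt ℝ (fun θ' => χ R θ') θ := by
    rw [e]; exact ((hχ.differentiable (by simp)) (R, θ)).comp θ ((differentiableAt_const _).prodMk differentiableAt_id)
  show deriv (fun θ' => Real.cos θ' * χ R θ') θ = -Real.sin θ * χ R θ + Real.cos θ * deriv (fun θ' => χ R θ') θ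
  exact ((Real.hasDerivAt_cos θ).mul hd.hasDerivAt).deriv

end profile

/-- The angular slice derivative vanishes off the topological support. [folklore] -/
theorem support_dθ_subset_tsupport (Ψ : ℝ → ℝ → ℝ) : support (uncurry (dθ Ψ)) ⊆ tsupport (uncurry Ψ) := by
  intro p hp
  by_contra h
  have hzero : uncurry Ψ =ᶠ[𝓝 p] 0 := notMem_tsupport_iff_eventuallyEq.1 h
  have ht : Tendsto (fun θ' => (p.1, θ')) (𝓝 p.2) (𝓝 p) := (Continuous.prodMk_right p.1).continuousAt
  have hsl : (fun θ' => Ψ p.1 θ') =ᶠ[𝓝 p.2] fun _ => 0 := (ht.eventually hzero).mono fun θ' h' => h'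
  have hd : dθ Ψ p.1 p.2 = 0 := by
    show deriv (fun θ' => Ψ p.1 θ') p.2 = 0
    rw [hsl.deriv_eq, deriv_const]
  exact hp hd

/-- Hence `tsupport (dθ Ψ) ⊆ tsupport Ψ`. [folklore] -/
theorem tsupport_dθ_subset' (Ψ : ℝ → ℝ → ℝ) : tsupport (uncurry (dθ Ψ)) ⊆ tsupport (uncurry Ψ) :=
  closure_minimal (support_dθ_subset_tsupport Ψ) (isClosed_tsupport _)

/-- The angular slice derivative of a compactly supported function is compactly supported. [folklore] -/
theorem hasCompactSupport_dθ_of {Ψ : ℝ → ℝ → ℝ} (hs : HasCompactSupport (uncurry Ψ)) :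
    HasCompactSupport (uncurry (dθ Ψ)) :=
  hs.mono' ((subset_tsupport _).trans (tsupport_dθ_subset' Ψ))

/-! ### The energy identity -/

/-- **The energy identity of the polar model operator** (Proposition 7.1, Step 2, first display):
for `Ψ = cosθ·χ`, `χ ∈ C²(ℝ²)` compactly supported with `χ(R,0) = 0`, and any real `α`,
`∫∫_strip L(Ψ)Ψ dRdθ = α²‖R∂_RΨ‖² + (α(5+α)/2 − α²)‖Ψ‖² + ‖∂_θΨ‖² − 6‖Ψ‖² + ½‖χ‖²`
(all norms in `L²(dRdθ)` of the strip; `χ = sec(θ)Ψ`). [cite: Elgindi2021, §7.1 proof of Proposition 7.1, Step 2 (p. 19 of arXiv:1904.04795)] -/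
theorem integral_strip_ellipticOp_mul_self (α : ℝ) {χ : ℝ → ℝ → ℝ} (hχ : ContDiff ℝ 2 (uncurry χ))
    (hs : HasCompactSupport (uncurry χ)) (hχ0 : ∀ R, χ R 0 = 0) {Ψ : ℝ → ℝ → ℝ}
    (hΨ : Ψ = fun R θ => Real.cos θ * χ R θ) :
    ∫ p in strip, ellipticOp α Ψ p.1 p.2 * Ψ p.1 p.2 =
      α ^ 2 * (∫ p in strip, (p.1 * dz Ψ p.1 p.2) ^ 2) + (α * (5 + α) / 2 - α ^ 2) * (∫ p in strip, Ψ p.1 p.2 ^ 2) +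
        (∫ p in strip, dθ Ψ p.1 p.2 ^ 2) - 6 * (∫ p in strip, Ψ p.1 p.2 ^ 2) +
        (1 / 2) * ∫ p in strip, χ p.1 p.2 ^ 2 := by
  -- regularity and support
  have hχ1 : ContDiff ℝ 1 (uncurry χ) := hχ.of_le (by norm_num)
  have hΨ2 : ContDiff ℝ 2 (uncurry Ψ) := by rw [hΨ]; exact contDiff_cosProfile hχ
  have hΨ1 : ContDiff ℝ 1 (uncurry Ψ) := hΨ2.of_le (by norm_num)
  have hΨs : HasCompactSupport (uncurry Ψ) := by rw [hΨ]; exact hasCompactSupport_cosProfile hs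
  have hdzΨ : ContDiff ℝ 1 (uncurry (dz Ψ)) := contDiff_dz_of_contDiff (n := 1) hΨ2
  have hdzΨs : HasCompactSupport (uncurry (dz Ψ)) := hasCompactSupport_dz hΨs
  have hdz2Ψc : Continuous (uncurry (dz (dz Ψ))) := continuous_dz hdzΨ
  have hdθΨ : ContDiff ℝ 1 (uncurry (dθ Ψ)) := contDiff_dθ_of_contDiff (n := 1) hΨ2
  have hdθΨs : HasCompactSupport (uncurry (dθ Ψ)) := hasCompactSupport_dθ_of hΨs
  have hdθ2Ψc : Continuous (uncurry (dθ (dθ Ψ))) := (contDiff_dθ_of_contDiff (n := 0) hdθΨ).continuous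
  have hdθχ : ContDiff ℝ 1 (uncurry (dθ χ)) := contDiff_dθ_of_contDiff (n := 1) hχ
  have hΨc : Continuous (uncurry Ψ) := hΨ2.continuous
  have hχc : Continuous (uncurry χ) := hχ.continuous
  have hdzΨc : Continuous (uncurry (dz Ψ)) := hdzΨ.continuous
  have hdθΨc : Continuous (uncurry (dθ Ψ)) := hdθΨ.continuous
  have hdθχc : Continuous (uncurry (dθ χ)) := hdθχ.continuous
  obtain ⟨b, hb⟩ := exists_forall_le_eq_zero hs
  set B : ℝ := max b 0 with hB
  have hB0 : 0 ≤ B := le_max_right _ _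
  have hbΨ : ∀ R, B ≤ R → ∀ θ, Ψ R θ = 0 := fun R hR θ => by
    rw [hΨ]; simp [hb R ((le_max_left _ _).trans hR) θ]
  -- Dirichlet data
  have hD0 : ∀ R, Ψ R 0 = 0 := fun R => by rw [hΨ]; simp [hχ0 R]
  have hD1 : ∀ R, Ψ R (π / 2) = 0 := fun R => by rw [hΨ]; simp
  -- continuity of the basic plane functions (as functions of `p : ℝ × ℝ`)
  have cΨ : Continuous fun p : ℝ × ℝ => Ψ p.1 p.2 := hΨc
  have cχ : Continuous fun p : ℝ × ℝ => χ p.1 p.2 := hχc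
  have cdz : Continuous fun p : ℝ × ℝ => dz Ψ p.1 p.2 := hdzΨc
  have cdz2 : Continuous fun p : ℝ × ℝ => dz (dz Ψ) p.1 p.2 := hdz2Ψc
  have cdθ : Continuous fun p : ℝ × ℝ => dθ Ψ p.1 p.2 := hdθΨc
  have cdθ2 : Continuous fun p : ℝ × ℝ => dθ (dθ Ψ) p.1 p.2 := hdθ2Ψc
  have cdθχ : Continuous fun p : ℝ × ℝ => dθ χ p.1 p.2 := hdθχc
  -- compact support of the basic plane functions
  have sΨ : HasCompactSupport fun p : ℝ × ℝ => Ψ p.1 p.2 := hΨs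
  have sχ : HasCompactSupport fun p : ℝ × ℝ => χ p.1 p.2 := hs
  have sdz : HasCompactSupport fun p : ℝ × ℝ => dz Ψ p.1 p.2 := hdzΨs
  have sdθ : HasCompactSupport fun p : ℝ × ℝ => dθ Ψ p.1 p.2 := hdθΨs
  -- the five integrands and their integrability on the plane
  set A : ℝ × ℝ → ℝ := fun p => -(p.1 ^ 2 * dz (dz Ψ) p.1 p.2) * Ψ p.1 p.2 with hA
  set Bf : ℝ × ℝ → ℝ := fun p => -(p.1 * dz Ψ p.1 p.2) * Ψ p.1 p.2 with hBf
  set C : ℝ × ℝ → ℝ := fun p => -dθ (dθ Ψ) p.1 p.2 * Ψ p.1 p.2 with hC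
  set D : ℝ × ℝ → ℝ := fun p => (Real.cos p.2 * χ p.1 p.2 + Real.sin p.2 * dθ χ p.1 p.2) * (Real.cos p.2 * χ p.1 p.2) with hD
  set E : ℝ × ℝ → ℝ := fun p => Ψ p.1 p.2 ^ 2 with hE
  have iA : Integrable A := ((by fun_prop : Continuous fun p : ℝ × ℝ => -(p.1 ^ 2 * dz (dz Ψ) p.1 p.2)).mul cΨ)
    |>.integrable_of_hasCompactSupport sΨ.mul_left
  have iB : Integrable Bf := ((by fun_prop : Continuous fun p : ℝ × ℝ => -(p.1 * dz Ψ p.1 p.2)).mul cΨ)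
    |>.integrable_of_hasCompactSupport sΨ.mul_left
  have iC : Integrable C := ((by fun_prop : Continuous fun p : ℝ × ℝ => -dθ (dθ Ψ) p.1 p.2).mul cΨ)
    |>.integrable_of_hasCompactSupport sΨ.mul_left
  have iD : Integrable D := ((by fun_prop : Continuous fun p : ℝ × ℝ => Real.cos p.2 * χ p.1 p.2 + Real.sin p.2 * dθ χ p.1 p.2).mul
    (by fun_prop : Continuous fun p : ℝ × ℝ => Real.cos p.2 * χ p.1 p.2)) |>.integrable_of_hasCompactSupport (sχ.mul_left).mul_left
  have sE : HasCompactSupport E := by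
    have : E = fun p : ℝ × ℝ => Ψ p.1 p.2 * Ψ p.1 p.2 := by funext p; simp [hE, sq]
    rw [this]; exact sΨ.mul_left
  have sZ : HasCompactSupport fun p : ℝ × ℝ => (p.1 * dz Ψ p.1 p.2) ^ 2 := by
    have : (fun p : ℝ × ℝ => (p.1 * dz Ψ p.1 p.2) ^ 2) = fun p : ℝ × ℝ => (p.1 * (p.1 * dz Ψ p.1 p.2)) * dz Ψ p.1 p.2 := by
      funext p; ring
    rw [this]; exact sdz.mul_left
  have sY : HasCompactSupport fun p : ℝ × ℝ => dθ Ψ p.1 p.2 ^ 2 := by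
    have : (fun p : ℝ × ℝ => dθ Ψ p.1 p.2 ^ 2) = fun p : ℝ × ℝ => dθ Ψ p.1 p.2 * dθ Ψ p.1 p.2 := by funext p; ring
    rw [this]; exact sdθ.mul_left
  have sX : HasCompactSupport fun p : ℝ × ℝ => χ p.1 p.2 ^ 2 := by
    have : (fun p : ℝ × ℝ => χ p.1 p.2 ^ 2) = fun p : ℝ × ℝ => χ p.1 p.2 * χ p.1 p.2 := by funext p; ring
    rw [this]; exact sχ.mul_left
  have cE : Continuous E := cΨ.pow 2
  have cZ : Continuous fun p : ℝ × ℝ => (p.1 * dz Ψ p.1 p.2) ^ 2 := by fun_prop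
  have cY : Continuous fun p : ℝ × ℝ => dθ Ψ p.1 p.2 ^ 2 := cdθ.pow 2
  have cX : Continuous fun p : ℝ × ℝ => χ p.1 p.2 ^ 2 := cχ.pow 2
  have iE : Integrable E := cE.integrable_of_hasCompactSupport sE
  have iZ : Integrable fun p : ℝ × ℝ => (p.1 * dz Ψ p.1 p.2) ^ 2 := cZ.integrable_of_hasCompactSupport sZ
  have iY : Integrable fun p : ℝ × ℝ => dθ Ψ p.1 p.2 ^ 2 := cY.integrable_of_hasCompactSupport sY
  have iX : Integrable fun p : ℝ × ℝ => χ p.1 p.2 ^ 2 := cX.integrable_of_hasCompactSupport sX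
  -- pointwise on the strip: `L(Ψ)Ψ = α²A + α(5+α)B + C + D − 6E`
  have hpt : ∀ p ∈ strip, ellipticOp α Ψ p.1 p.2 * Ψ p.1 p.2 =
      α ^ 2 * A p + α * (5 + α) * Bf p + C p + D p - 6 * E p := by
    intro p hp
    have hcos : Real.cos p.2 ≠ 0 := (Real.cos_pos_of_mem_Ioo ⟨by linarith [hp.2.1, Real.pi_pos], hp.2.2⟩).ne'
    have hT : Real.cos p.2 * χ p.1 p.2 / Real.cos p.2 ^ 2 +
        Real.sin p.2 * (-Real.sin p.2 * χ p.1 p.2 + Real.cos p.2 * dθ χ p.1 p.2) / Real.cos p.2 =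
        Real.cos p.2 * χ p.1 p.2 + Real.sin p.2 * dθ χ p.1 p.2 := by
      rw [div_add_div _ _ (pow_ne_zero 2 hcos) hcos, div_eq_iff (mul_ne_zero (pow_ne_zero 2 hcos) hcos)]
      have := Real.sin_sq_add_cos_sq p.2
      linear_combination (-(Real.cos p.2 ^ 2 * χ p.1 p.2)) * this
    have hΨp : Ψ p.1 p.2 = Real.cos p.2 * χ p.1 p.2 := by rw [hΨ]
    have hdθp : dθ Ψ p.1 p.2 = -Real.sin p.2 * χ p.1 p.2 + Real.cos p.2 * dθ χ p.1 p.2 := by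
      rw [hΨ, dθ_cosProfile hχ1]
    have hud : DifferentiableAt ℝ (fun θ' => Ψ p.1 θ') p.2 :=
      ((hΨ2.comp (contDiff_const.prodMk contDiff_id)).differentiable (by simp)) p.2
    rw [ellipticOp_eq_expanded α hud hcos]
    simp only [hA, hBf, hC, hD, hE]
    rw [hdθp, hΨp, hT]
    ring
  -- slices: compact support and regularity
  have sliceR_supp : ∀ (G : ℝ × ℝ → ℝ), HasCompactSupport G → ∀ θ : ℝ, HasCompactSupport fun R => G (R, θ) :=
    fun G hG θ => HasCompactSupport.of_support_subset_isCompact (hG.image continuous_fst) fun R hR =>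
      ⟨(R, θ), subset_tsupport G hR, rfl⟩
  have sliceθ_supp : ∀ (G : ℝ × ℝ → ℝ), HasCompactSupport G → ∀ R : ℝ, HasCompactSupport fun θ => G (R, θ) :=
    fun G hG R => HasCompactSupport.of_support_subset_isCompact (hG.image continuous_snd) fun θ hθ =>
      ⟨(R, θ), subset_tsupport G hθ, rfl⟩
  have hvR : ∀ θ, ContDiff ℝ 2 fun R => Ψ R θ := fun θ => hΨ2.comp (contDiff_id.prodMk contDiff_const)
  have huθ : ∀ R, ContDiff ℝ 2 fun θ => Ψ R θ := fun R => hΨ2.comp (contDiff_const.prodMk contDiff_id)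
  have hχθ : ∀ R, ContDiff ℝ 1 fun θ => χ R θ := fun R => hχ1.comp (contDiff_const.prodMk contDiff_id)
  -- the slice derivatives are the tree's `dz`, `dθ`
  have hdv : ∀ θ, deriv (fun R => Ψ R θ) = fun R => dz Ψ R θ := fun θ => rfl
  have hddv : ∀ θ, deriv (deriv fun R => Ψ R θ) = fun R => dz (dz Ψ) R θ := fun θ => by rw [hdv θ]; rfl
  have hdu : ∀ R, deriv (fun θ => Ψ R θ) = fun θ => dθ Ψ R θ := fun R => rfl
  have hddu : ∀ R, deriv (deriv fun θ => Ψ R θ) = fun θ => dθ (dθ Ψ) R θ := fun R => by rw [hdu R]; rfl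
  have hdχ : ∀ R, deriv (fun θ => χ R θ) = fun θ => dθ χ R θ := fun R => rfl
  -- generic: a plane-integrable function whose `R`-slices integrate to zero has zero strip integral
  have vanishR : ∀ (G : ℝ × ℝ → ℝ), Integrable G → (∀ θ ∈ Ioo 0 (π / 2), ∫ R in Ioi (0 : ℝ), G (R, θ) = 0) →
      ∫ p in strip, G p = 0 := by
    intro G hG h
    rw [integral_strip_eq_integral_Ioo_integral_Ioi hG]
    exact setIntegral_eq_zero_of_forall_eq_zero h
  have vanishθ : ∀ (G : ℝ × ℝ → ℝ), Integrable G → (∀ R ∈ Ioi (0 : ℝ), ∫ θ in Ioo 0 (π / 2), G (R, θ) = 0) →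
      ∫ p in strip, G p = 0 := by
    intro G hG h
    rw [integral_strip_eq_integral_Ioi_integral_Ioo hG]
    exact setIntegral_eq_zero_of_forall_eq_zero h
  -- integrability of slices of continuous compactly supported plane functions
  have intR : ∀ (G : ℝ × ℝ → ℝ), Continuous G → HasCompactSupport G → ∀ θ, Integrable fun R => G (R, θ) :=
    fun G hG hGs θ => (hG.comp (Continuous.prodMk_left θ)).integrable_of_hasCompactSupport (sliceR_supp G hGs θ)
  have intθ : ∀ (G : ℝ × ℝ → ℝ), Continuous G → ∀ R, IntegrableOn (fun θ => G (R, θ)) (Ioo 0 (π / 2)) :=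
    fun G hG R => ((hG.comp (Continuous.prodMk_right R)).continuousOn.integrableOn_Icc (a := 0) (b := π / 2)).mono_set
      Ioo_subset_Icc_self
  -- continuity + compact support of the five integrands (as plane functions)
  have cA : Continuous A := (by fun_prop : Continuous fun p : ℝ × ℝ => -(p.1 ^ 2 * dz (dz Ψ) p.1 p.2)).mul cΨ
  have cB : Continuous Bf := (by fun_prop : Continuous fun p : ℝ × ℝ => -(p.1 * dz Ψ p.1 p.2)).mul cΨ
  have cC : Continuous C := (by fun_prop : Continuous fun p : ℝ × ℝ => -dθ (dθ Ψ) p.1 p.2).mul cΨ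
  have cD : Continuous D := by simp only [hD]; fun_prop
  have sA : HasCompactSupport A := sΨ.mul_left
  have sB : HasCompactSupport Bf := sΨ.mul_left
  -- TERM A: `∫∫A = ∫∫Z − ∫∫E`
  have hTA : ∫ p in strip, A p = (∫ p in strip, (p.1 * dz Ψ p.1 p.2) ^ 2) - ∫ p in strip, E p := by
    have h0 := vanishR (fun p => A p - (p.1 * dz Ψ p.1 p.2) ^ 2 + E p) ((iA.sub iZ).add iE) (fun θ _ => by
      have h1 := integral_Ioi_neg_sq_mul_deriv2_mul (hvR θ) hB0 (fun R hR => hbΨ R hR θ)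
      rw [hddv θ, hdv θ] at h1
      have j1 : IntegrableOn (fun R => -(R ^ 2 * dz (dz Ψ) R θ) * Ψ R θ) (Ioi 0) := (intR A cA sA θ).integrableOn
      have j2 : IntegrableOn (fun R => (R * dz Ψ R θ) ^ 2) (Ioi 0) := (intR _ cZ sZ θ).integrableOn
      have j3 : IntegrableOn (fun R => Ψ R θ ^ 2) (Ioi 0) := (intR E cE sE θ).integrableOn
      have j12 : IntegrableOn (fun R => -(R ^ 2 * dz (dz Ψ) R θ) * Ψ R θ - (R * dz Ψ R θ) ^ 2) (Ioi 0) := j1.sub j2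
      simp only [hA, hE]
      rw [integral_add j12 j3, integral_sub j1 j2]
      simp only at h1
      linarith)
    have k1 : IntegrableOn (fun p : ℝ × ℝ => A p - (p.1 * dz Ψ p.1 p.2) ^ 2) strip := (iA.sub iZ).integrableOn
    rw [integral_add k1 iE.integrableOn, integral_sub iA.integrableOn iZ.integrableOn] at h0
    linarith
  -- TERM B: `∫∫B = ½∫∫E`
  have hTB : ∫ p in strip, Bf p = (1 / 2) * ∫ p in strip, E p := by
    have h0 := vanishR (fun p => Bf p - (1 / 2) * E p) (iB.sub (iE.const_mul _)) (fun θ _ => by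
      have h1 := integral_Ioi_neg_mul_deriv_mul ((hvR θ).of_le (by norm_num)) hB0 (fun R hR => hbΨ R hR θ)
      rw [hdv θ] at h1
      have j1 : IntegrableOn (fun R => -(R * dz Ψ R θ) * Ψ R θ) (Ioi 0) := (intR Bf cB sB θ).integrableOn
      have j3 : IntegrableOn (fun R => (1 / 2) * Ψ R θ ^ 2) (Ioi 0) := ((intR E cE sE θ).const_mul _).integrableOn
      simp only [hBf, hE]
      rw [integral_sub j1 j3, MeasureTheory.integral_const_mul]
      simp only at h1
      linarith)
    have k3 : IntegrableOn (fun p : ℝ × ℝ => (1 / 2) * E p) strip := (iE.const_mul _).integrableOn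
    rw [integral_sub iB.integrableOn k3, MeasureTheory.integral_const_mul] at h0
    linarith
  -- TERM C: `∫∫C = ∫∫Y`
  have hTC : ∫ p in strip, C p = ∫ p in strip, dθ Ψ p.1 p.2 ^ 2 := by
    have h0 := vanishθ (fun p => C p - dθ Ψ p.1 p.2 ^ 2) (iC.sub iY) (fun R _ => by
      have h1 := integral_neg_deriv2_mul_dirichlet (huθ R) (hD0 R) (hD1 R)
      rw [hddu R, hdu R] at h1
      rw [intervalIntegral.integral_of_le (by positivity), intervalIntegral.integral_of_le (by positivity),
        integral_Ioc_eq_integral_Ioo, integral_Ioc_eq_integral_Ioo] at h1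
      have j1 : IntegrableOn (fun θ => -dθ (dθ Ψ) R θ * Ψ R θ) (Ioo 0 (π / 2)) := intθ C cC R
      have j2 : IntegrableOn (fun θ => dθ Ψ R θ ^ 2) (Ioo 0 (π / 2)) := intθ _ cY R
      simp only [hC]
      rw [integral_sub j1 j2]
      simp only at h1
      linarith)
    rw [integral_sub iC.integrableOn iY.integrableOn] at h0
    linarith
  -- TERM D: `∫∫D = ½∫∫X`
  have hTD : ∫ p in strip, D p = (1 / 2) * ∫ p in strip, χ p.1 p.2 ^ 2 := by
    have h0 := vanishθ (fun p => D p - (1 / 2) * χ p.1 p.2 ^ 2) (iD.sub (iX.const_mul _)) (fun R _ => by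
      have h1 := integral_tanTerm_mul (hχθ R)
      rw [hdχ R] at h1
      rw [intervalIntegral.integral_of_le (by positivity), intervalIntegral.integral_of_le (by positivity),
        integral_Ioc_eq_integral_Ioo, integral_Ioc_eq_integral_Ioo] at h1
      have j1 : IntegrableOn (fun θ => (Real.cos θ * χ R θ + Real.sin θ * dθ χ R θ) * (Real.cos θ * χ R θ)) (Ioo 0 (π / 2)) :=
        intθ D cD R
      have j2 : IntegrableOn (fun θ => (1 / 2) * χ R θ ^ 2) (Ioo 0 (π / 2)) := (intθ _ cX R).const_mul _
      simp only [hD]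
      rw [integral_sub j1 j2, MeasureTheory.integral_const_mul]
      simp only at h1
      linarith)
    have k3 : IntegrableOn (fun p : ℝ × ℝ => (1 / 2) * χ p.1 p.2 ^ 2) strip := (iX.const_mul _).integrableOn
    rw [integral_sub iD.integrableOn k3, MeasureTheory.integral_const_mul] at h0
    linarith
  -- assemble
  rw [setIntegral_congr_fun measurableSet_strip hpt]
  have i1 : IntegrableOn (fun p => α ^ 2 * A p) strip := (iA.const_mul _).integrableOn
  have i2 : IntegrableOn (fun p => α * (5 + α) * Bf p) strip := (iB.const_mul _).integrableOn
  have i3 : IntegrableOn C strip := iC.integrableOn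
  have i4 : IntegrableOn D strip := iD.integrableOn
  have i5 : IntegrableOn (fun p => 6 * E p) strip := (iE.const_mul _).integrableOn
  have k12 : IntegrableOn (fun p => α ^ 2 * A p + α * (5 + α) * Bf p) strip := i1.add i2
  have k123 : IntegrableOn (fun p => α ^ 2 * A p + α * (5 + α) * Bf p + C p) strip := k12.add i3
  have k1234 : IntegrableOn (fun p => α ^ 2 * A p + α * (5 + α) * Bf p + C p + D p) strip := k123.add i4
  rw [integral_sub k1234 i5, integral_add k123 i4, integral_add k12 i3, integral_add i1 i2, MeasureTheory.integral_const_mul,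
    MeasureTheory.integral_const_mul, MeasureTheory.integral_const_mul, hTA, hTB, hTC, hTD]
  simp only [hE]
  ring

end Elgindi

end Literature.Analysis.FluidPDE
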